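/-
Copyright: the b2b-balaban cell (near-miss cell 7), T⁴-continuum fan-out; row NE7b ROUND-2 swarm, seat
t4-ne7b-formalise-leaf-03 (gen 3) (row S12 «ASSEMBLY», repair row S12j «THRESHOLD-PAID MULTIPLICITY» of
`t4/b2b-balaban-t4-ne7b-p1/LEAVES-NE7b.md`, ruling R-OWNER-23-10 (2)(b); node A12-I.M of the typer's
`t4/formal/NE7b/DAG.md`).  Released under the licence of the surrounding project.
-/
import Summits.QuantumFields.BalabanUV.T4Continuum.Support.HistoryAssemblyRealiseMult
import Summits.QuantumFields.BalabanUV.T4Continuum.Support.HistoryAssemblyMultProfile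
import Summits.QuantumFields.BalabanUV.T4Continuum.Support.HistoryAssemblyMultKey
import Summits.QuantumFields.BalabanUV.T4Continuum.Support.HistoryAssemblyRealiseRun

/-!
# History assembly, realised per run: THE PER-RUN MULTIPLICITY SOCKET WITH THE SLACK READ AT A PROFILE LEVEL (row S12j)

Summits-side support file of the T⁴-continuum cell (rung (B)+1 on a FINITE torus only; NOT infinite volume, NOT the
mass gap, NOT the Clay statement; NOT a proof of the spine estimate NE7b).  Row NE7b, route «COUNT», repair row S12j
«THRESHOLD-PAID MULTIPLICITY» (R-OWNER-23-10 on finding F-leaf08g7-1): the per-run multiplicity socket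
`HistoryAssemblyRealiseRunMult.hybridNE7_of_realisedRun_printedMult` (gen 2, p219408) with the class-linear slack read
AT A DISPLAYED PROFILE LEVEL `P` instead of the profile floor.  [folklore] the SAME composition by name
(`HistoryAssemblyRealiseMult.hybridNE7_of_termReadingLE_mult` over `HistoryAssemblyRealiseRun.termReadingLE_of_realisedR`,
`HistoryAssemblyMultKey`), with `HistoryAssemblyMultProfile.card_mul_pshapeTH_le_priceT_of_profile` in place of
`HistoryAssemblyMult.card_mul_pshapeTH_le_priceT`; no definition, no `[cite:]` tag, nothing printed asserted.

WHAT.  **`hybridNE7_of_realisedRun_printedMultP`**: binder diff against p219408's END — `hA₀ : 1 ≤ C.A₀` (the profile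
FLOOR) ↦ {`P`, `hP1 : 1 ≤ P`, **`hP : ∀ K ≥ K₀, ∀ s ≤ K, P ≤ p0Profile C.A₀ C.p₀ ((D.C ⟨K, F.m, g₀ K⟩).flow.g s)`**}
(ONE number below the profile along every run — along asymptotically free runs `p₀` at the INFRARED THRESHOLD, so in the
pinned ∕ apex form `hP` is DISCHARGED from the threshold and `P` grows with it), and `hmult` re-lettered to
`#koccOf … ≤ exp(θ·P·birthLinT Prod.fst ((ped K τ).genT c) + Ξ K (·, (ped K τ).genT c))·Λm^{partnerAges …}`; everything
else VERBATIM; conclusion identical.  WHY: with `θ` slack-paid at the floor `p₀ ≥ 1`, row S6g′'s instance constant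
forces `½γ₀A₁² > 8·8710^d` of print's O(1)'s (F-leaf08g7-1 — vacuous for O(1) constants); at the level `P` the same
instance needs only `ΘJ + … ≤ θ·P`, i.e. a larger coupling threshold — print's own mechanism (`e^{O(1)|X|}` paid by
`e^{−p₀(g_k)|X|}`, `p₀(g_k) → ∞` in the window).

HONEST.  Composition + arithmetic over OUR carriers; `hP` and `hslack` are DISPLAYED; nothing of H3 ∕ (B) ∕ BetaPertH ∕
NE7c ∕ NE7 discharged; `hmult` displayed here (the S12j junction plugs it); NE7b NOT proved; spine 0∕9.  HONEST
DEPENDENCY (cell): continuum YM on T⁴ ⇐ BetaPertH ∧ nine spine estimates (0/9 proved); BetaPertH ⇐ (D1) ∧ (D4) ∧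
CAP+tail; G-an2-4 gates asym, D1 and NE2/3/4.  This file changes none of it.
-/

open Finset MeasureTheory
open Literature.MathematicalPhysics.QuantumFieldTheory.Balaban1983to89
open T4PersistenceDictionary T4PersistentHistoryCount T4BankedInduction T4PrintedShapeBanking
open T4WeightBudget T4GlobalDenominator T4LiveClassFibration T4LiveStructureGas T4LiveGasToTerms T4RecordPriceSeam
open T4PartnerMultiplicity T4IndicatorShell T4MatchingAssembly T4MatchingClosure T4MatchingClosureSocket T4Continuum
open T4StabilitySocket T4BranchingRecordsGas T4TaggedShapeBanking T4CanonicalMenus T4RenewalChains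
open Summit.QuantumFields.BalabanUV.T4Continuum.PlacementBatch
open Summit.QuantumFields.BalabanUV.T4Continuum.PlacementSkeleton
open Summit.QuantumFields.BalabanUV.T4Continuum.CountThresholdUniform
open Summit.QuantumFields.BalabanUV.T4Continuum.CountThresholdExit
open Summit.QuantumFields.BalabanUV.T4Continuum.CountSeamJunction
open Summit.QuantumFields.BalabanUV.T4Continuum.LateMergers
open Summit.QuantumFields.BalabanUV.T4Continuum.HistoryFlow
open Summit.QuantumFields.BalabanUV.T4Continuum.HistoryRegeneration
open Summit.QuantumFields.BalabanUV.T4Continuum.HistoryTables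
open Summit.QuantumFields.BalabanUV.T4Continuum.HistoryAssemblyTrees
open Summit.QuantumFields.BalabanUV.T4Continuum.HistoryAssemblyTerms
open Summit.QuantumFields.BalabanUV.T4Continuum.HistoryAssemblyPedigree
open Summit.QuantumFields.BalabanUV.T4Continuum.HistoryConstants
open Summit.QuantumFields.BalabanUV.T4Continuum.HistoryGen
open Literature.MathematicalPhysics.QuantumFieldTheory.Balaban1983to89.B13ScaleTransfer
open Summit.QuantumFields.BalabanUV.T4Continuum.ZoneSkeleton
open Summit.QuantumFields.BalabanUV.T4Continuum.HistorySocketTH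
open Summit.QuantumFields.BalabanUV.T4Continuum.HistoryCaps
open Summit.QuantumFields.BalabanUV.T4Continuum.HistoryAssemblyPrice
open Summit.QuantumFields.BalabanUV.T4Continuum.HistoryBankingLE
open Summit.QuantumFields.BalabanUV.T4Continuum.HistoryExitLE
open Summit.QuantumFields.BalabanUV.T4Continuum.HistoryAssemblyTreesLE
open Summit.QuantumFields.BalabanUV.T4Continuum.HistoryAssemblyTermsLE
open Summit.QuantumFields.BalabanUV.T4Continuum.HistoryRealise
open Summit.QuantumFields.BalabanUV.T4Continuum.HistoryAssemblyRealiseLE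
open Summit.QuantumFields.BalabanUV.T4Continuum.HistoryAssemblyMult
open Summit.QuantumFields.BalabanUV.T4Continuum.HistoryAssemblyMultKey
open Summit.QuantumFields.BalabanUV.T4Continuum.HistoryAssemblyRealiseRun
open Summit.QuantumFields.BalabanUV.T4Continuum.HistoryAssemblyRealiseMult
open Summit.QuantumFields.BalabanUV.T4Continuum.HistoryAssemblyMultProfile

namespace Summit.QuantumFields.BalabanUV.T4Continuum.HistoryAssemblyRealiseRunMultP

noncomputable section

/-! ## The per-run END with the slot multiplicity displayed at a profile level -/

section End

variable {F : T4Family} {G : Type*} [GaugeGroup G] [MeasurableSpace G] [HaarData G] [RegularGaugeGroup G]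
variable {α π δ : Type*} [DecidableEq α] [DecidableEq π] [DecidableEq δ] {dP : ℕ}
variable {ι : Type*} [DecidableEq ι] {l₀ vol : ℝ} {K₀ : ℕ} {T : ℕ → Finset ι} {A A' shA shB : ℕ → ℝ → ι → ℝ}
  {dead dead' : ℕ → ℝ → ι → ℝ} {nup mup : ℕ → ℝ → ℝ} {Nup : ℝ}
  {Cc Rr CcRec RrRec : ℕ → ℝ → ι → ℝ} {ν u s₂ q₀ r s Wsh : ℕ → ℝ}

/-- **NE7b's COUNT EXIT, PER RUN, WITH THE SLOT MULTIPLICITY DISPLAYED AT A PROFILE LEVEL `P`** (row S12j):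
= `HistoryAssemblyRealiseRunMult.hybridNE7_of_realisedRun_printedMult` with `hA₀` ↦ {`P`, `hP1`, `hP`} and `hmult` at
`exp(θ·P·birthLinT … + Ξ …)`; the per-occupant price bound by
`HistoryAssemblyMultProfile.card_mul_pshapeTH_le_priceT_of_profile`.  Conclusion identical. [folklore] -/
theorem hybridNE7_of_realisedRun_printedMultP (D : FiniteEpsData F G) {C : T4PrintedShapeBanking.Consts}
    {O : PrintedO1s}
    {rr : ℕ} {β₀ : ℝ} (h : ThresholdOK C F.L rr β₀) (hμ : 0 < C.μ) (d n : ℕ)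
    (hκ₁ : (d : ℝ) * Real.log F.L + 2 * Real.log 2 ≤ C.κ₁) (hE₀ : Real.log (2 + birthMass C) ≤ C.E₀)
    -- the flow side (⇐ BetaPertH, displayed) and tuning
    {γ₀ γb b β' : ℝ} {pe : ℕ} (hb : 0 ≤ b) (hlo : FlowStep.BetaLowerH b γ₀ D.βfun)
    (hhi : FlowStep.BetaUpperH β' γ₀ D.βfun) (hγ : γb ≤ γ₀) (hγβ : γb ^ 2 * β' < 1)
    (S : B14FlowStep.SmallnessFor γb β' β₀ F.L pe) (hp₀ : C.p₀ ≤ pe) (hrr : rr ≤ pe) (hβ : β₀ ≤ 1 / 2)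
    {g : ℝ} {g₀ : ℕ → ℝ} (ht : D.Tuned γb g g₀)
    (hir : irThresholdTLE C F.L rr β₀ ≤ Real.log (g ^ 2)⁻¹)
    -- row S12j: a displayed profile LEVEL `P ≥ 1` below `p₀(g_K(s))` along every run (in the pinned ∕ apex form it is
    -- DISCHARGED from the infrared threshold: `p₀` at the threshold) — the class-linear slack is read AT THIS LEVEL
    {P : ℝ} (hP1 : 1 ≤ P)
    (hP : ∀ K, K₀ ≤ K → ∀ s, s ≤ K → P ≤ p0Profile C.A₀ C.p₀ ((D.C ⟨K, F.m, g₀ K⟩).flow.g s))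
    -- the (B) side
    (hsign : B16.SignConventions D.C) {γB : ℝ} {em ep : ℝ → ℝ} (hcor : B16.Cor3With D.C γB em ep) (hγB : γb ≤ γB)
    {obs : (K : ℕ) → GaugeField (F.P K) 0 G → ℝ} {B : ℝ}
    (hobs : ∀ K, Measurable (obs K)) (hbd : ∀ K U, |obs K U| ≤ B)
    (hα : ∀ K t, |t| ≤ l₀ → K₀ ≤ K →
      ∫ U, Real.exp (t * obs K U) * D.dens K (g₀ K) 0 U ∂fieldMeasure (F.P K) 0 G ≤ ∑ τ ∈ T K, A K t τ)
    (hα' : ∀ K t, |t| ≤ l₀ → K₀ ≤ K →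
      ∫ U, Real.exp (t * obs (K + 1) U) * D.dens (K + 1) (g₀ (K + 1)) 0 U ∂fieldMeasure (F.P (K + 1)) 0 G ≤
        ∑ τ ∈ T K, A' K t τ)
    {c₀ n₁ : ℝ} (hc₀ : 0 < c₀) (hfloor : ∀ K, K₀ ≤ K → c₀ ≤ smallFieldMass D K (g₀ K))
    (hfloor' : ∀ K, K₀ ≤ K → c₀ ≤ smallFieldMass D (K + 1) (g₀ (K + 1)))
    (hsites : ∀ K, K₀ ≤ K → ((D.C ⟨K, F.m, g₀ K⟩).numSites K : ℝ) ≤ n₁)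
    (hsites' : ∀ K, K₀ ≤ K → ((D.C ⟨K + 1, F.m, g₀ (K + 1)⟩).numSites (K + 1) : ℝ) ≤ n₁)
    (hNup : 0 ≤ Nup) (hnup : ∀ K t, |t| ≤ l₀ → K₀ ≤ K → 0 ≤ nup K t ∧ nup K t ≤ Nup)
    (hmup : ∀ K t, |t| ≤ l₀ → K₀ ≤ K → 0 ≤ mup K t ∧ mup K t ≤ Nup)
    -- the (2.5) side condition on the size function
    (R : ℕ → ℕ → ℕ) (hR : ∀ K s, s ≤ K → B14.IsRj F.L rr ((D.C ⟨K, F.m, g₀ K⟩).flow.g s) (R K s))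
    -- the side conditions of the geometric lemmas (row S1b): torus side, window constant, sizes (NO drop control)
    (hL4 : 4 ≤ F.L) (hn₁ : 13 ≤ C.n₁) (hR1 : ∀ K, K₀ ≤ K → ∀ t, 1 ≤ R K t)
    -- H3: the terms read as pedigrees REALISED BY THE RUN'S OWN PROFILE, pending, with root cells
    (ped : ℕ → ι → Pedigree α π) (cellP : ℕ → ι → π → Pt dP × Finset (Pt dP)) (liveC : ℕ → ι → Finset α)
    (cellOf : ℕ → ι → α → (Fin d → ℕ))
    (H : RealisedReadingR F.L (runProfile F.L R) (cellN d n F.L) K₀ R T ped cellP liveC cellOf)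
    -- the PHYSICAL READING of the live components (the consumer's datum: which components of different terms are the same)
    (phys : ℕ → ι → α → δ)
    -- the class-linear slack: `C.a + θ ≤ ½γ₀A₁²` (ANY positive slack) pays `e^{θ·P·birthLinT}` at the level `P`
    {θ : ℝ} (hθ : 0 ≤ θ) (hslack : C.a + θ ≤ O.γ₀ * O.A₁ ^ 2 / 2)
    -- the partner letters: `Λm` for the slot multiplicity, `Λr` left in H3's printed price, `Λm·Λr ≤ L^d`
    {Λm Λr : ℝ} (hΛm : 0 ≤ Λm) (hΛr : 0 ≤ Λr) (hΛmr : Λm * Λr ≤ (F.L : ℝ) ^ d)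
    -- H3: realised per-step costs of the live members, read below the model's booked cost (reading (ID-a))
    (κ κ' : ℕ → (Fin d → ℕ) × Gen (Lab α π) → Gen (Lab α π) → ℕ → ℝ)
    (hκ : ∀ K, K₀ ≤ K → ∀ τ ∈ badTerms (memOf ped liveC cellOf) jhalf T K, ∀ q ∈ memOf ped liveC cellOf K τ,
      ∀ m ∈ life (padW (dictWT Prod.fst (R K) C.n₁) 0) q.2,
        κ K q q.2 m ≤ costT Prod.fst C K (R K) q.2 m)
    (hκ' : ∀ K, K₀ ≤ K → ∀ τ ∈ badTerms (memOf ped liveC cellOf) jhalf T K, ∀ q ∈ memOf ped liveC cellOf K τ,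
      ∀ m ∈ life (padW (dictWT Prod.fst (R K) C.n₁) 0) q.2,
        κ' K q q.2 m ≤ costT Prod.fst C K (R K) q.2 m)
    -- row S6g′'s INSTANCE: the renewal-entropy allowance `Ξ` and THE SLOT MULTIPLICITY OF THE PHYSICAL MEMBERS
    (Ξ : ℕ → (Fin d → ℕ) × Gen (Lab α π) → ℝ)
    (hmult : ∀ K, K₀ ≤ K → ∀ τ ∈ badTerms (memOf ped liveC cellOf) jhalf T K, ∀ c ∈ liveC K τ,
      ((koccOf ped liveC cellOf phys jhalf T K (kslot (keyOf ped cellOf phys K τ c))).card : ℝ) ≤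
        Real.exp (θ * P * birthLinT Prod.fst ((ped K τ).genT c) + Ξ K (cellOf K τ c, (ped K τ).genT c)) *
          Λm ^ partnerAges (PEv.step ∘ Prod.fst) ((ped K τ).genT c))
    -- H3: the per-term price sentence over the named members in PRINT's currency, discounted by the allowance; the
    -- live price of the PHYSICAL member family; both runs
    {FcM RfM FcM' RfM' : ℕ → Finset ((Fin d → ℕ) × Gen PEv × δ) → ℝ}
    (hPM : ∀ K t, |t| ≤ l₀ → K₀ ≤ K → ∀ τ ∈ badTerms (memOf ped liveC cellOf) jhalf T K,
      FcM K (kmemOf ped liveC cellOf phys K τ) * RfM K (kmemOf ped liveC cellOf phys K τ) ≤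
        ∏ q ∈ memOf ped liveC cellOf K τ,
          pshapeTH Prod.fst O C 1 Λr (R K) (D.C ⟨K, F.m, g₀ K⟩).flow.g 0 (κ K q) q.2 * Real.exp (-Ξ K q))
    (hPM' : ∀ K t, |t| ≤ l₀ → K₀ ≤ K → ∀ τ ∈ badTerms (memOf ped liveC cellOf) jhalf T K,
      FcM' K (kmemOf ped liveC cellOf phys K τ) * RfM' K (kmemOf ped liveC cellOf phys K τ) ≤
        ∏ q ∈ memOf ped liveC cellOf K τ,
          pshapeTH Prod.fst O C 1 Λr (R K) (D.C ⟨K, F.m, g₀ K⟩).flow.g 0 (κ' K q) q.2 * Real.exp (-Ξ K q))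
    -- H3: the remaining `Regeneration` numerator readings, over the PHYSICAL member families of the bad terms
    (upM : ∀ K t, |t| ≤ l₀ → K₀ ≤ K →
      ∀ k ∈ badGMems (memOf ped liveC cellOf) jhalf T (kmemOf ped liveC cellOf phys) K,
        ∀ τ ∈ fibre (kmemOf ped liveC cellOf phys) T K k, A K t τ ≤ dead K t τ * FcM K k * nup K t)
    (deadM_nonneg : ∀ K t, |t| ≤ l₀ → K₀ ≤ K →
      ∀ k ∈ badGMems (memOf ped liveC cellOf) jhalf T (kmemOf ped liveC cellOf phys) K,
        ∀ τ ∈ fibre (kmemOf ped liveC cellOf phys) T K k, 0 ≤ dead K t τ)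
    (resumM : ∀ K t, |t| ≤ l₀ → K₀ ≤ K →
      ∀ k ∈ badGMems (memOf ped liveC cellOf) jhalf T (kmemOf ped liveC cellOf phys) K,
        ∑ τ ∈ fibre (kmemOf ped liveC cellOf phys) T K k, dead K t τ ≤ RfM K k)
    (FM_nonneg : ∀ K t, |t| ≤ l₀ → K₀ ≤ K →
      ∀ k ∈ badGMems (memOf ped liveC cellOf) jhalf T (kmemOf ped liveC cellOf phys) K, 0 ≤ FcM K k)
    (upM' : ∀ K t, |t| ≤ l₀ → K₀ ≤ K →
      ∀ k ∈ badGMems (memOf ped liveC cellOf) jhalf T (kmemOf ped liveC cellOf phys) K,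
        ∀ τ ∈ fibre (kmemOf ped liveC cellOf phys) T K k, A' K t τ ≤ dead' K t τ * FcM' K k * mup K t)
    (deadM'_nonneg : ∀ K t, |t| ≤ l₀ → K₀ ≤ K →
      ∀ k ∈ badGMems (memOf ped liveC cellOf) jhalf T (kmemOf ped liveC cellOf phys) K,
        ∀ τ ∈ fibre (kmemOf ped liveC cellOf phys) T K k, 0 ≤ dead' K t τ)
    (resumM' : ∀ K t, |t| ≤ l₀ → K₀ ≤ K →
      ∀ k ∈ badGMems (memOf ped liveC cellOf) jhalf T (kmemOf ped liveC cellOf phys) K,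
        ∑ τ ∈ fibre (kmemOf ped liveC cellOf phys) T K k, dead' K t τ ≤ RfM' K k)
    (FM'_nonneg : ∀ K t, |t| ≤ l₀ → K₀ ≤ K →
      ∀ k ∈ badGMems (memOf ped liveC cellOf) jhalf T (kmemOf ped liveC cellOf phys) K, 0 ≤ FcM' K k)
    -- the seam's other inputs
    (hSh : ShellWeightBound l₀ T A A' shA shB Wsh)
    (hTB : ReindexedBudget l₀ vol T (fun K t τ => A K t τ - shA K t τ) (fun K t τ => A' K t τ - shB K t τ)
      (badOfClass (bstrOf Prod.fst (memOf ped liveC cellOf)) T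
        (fun K _ => badClasses Prod.fst (memOf ped liveC cellOf) jhalf T K)) Cc Rr CcRec RrRec ν u s₂ q₀ r s)
    (hr : Summable r) (hu : Summable u) (hs : Summable s) (hs₂ : Summable s₂) :
    ∃ K₁ K₂, K₀ ≤ K₁ ∧ HybridNE7 l₀ vol (fun K => T (K₁ + (K₂ + K))) (fun K => A (K₁ + (K₂ + K)))
      (fun K => A' (K₁ + (K₂ + K)))
      (fun K => badOfClass (bstrOf Prod.fst (memOf ped liveC cellOf)) T
        (fun K _ => badClasses Prod.fst (memOf ped liveC cellOf) jhalf T K) (K₁ + (K₂ + K)))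
      (fun K => constOf l₀ B (max (em g) 0) n₁ c₀ Nup *
        recordsBudget (birthMass C) C.κ₁ ((n : ℝ) ^ d) ((F.L : ℝ) ^ d) (Real.log 2) jhalf (K₁ + (K₂ + K)))
      (fun K => shA (K₁ + (K₂ + K))) (fun K => shB (K₁ + (K₂ + K))) (fun K => Wsh (K₁ + (K₂ + K)))
      (fun K => (r (K₁ + (K₂ + K)) + u (K₁ + (K₂ + K))) + (s (K₁ + (K₂ + K)) + s₂ (K₁ + (K₂ + K)))) := by
  -- the profile level at the members' birth steps: `ConsistentTLE.step_le` + the displayed `hP`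
  have HT := termReadingLE_of_realisedR (C := C) hL4
    (fun K _ => dropCtl_runProfile D hb hlo hhi hγ hγβ S hrr hβ ht R hR K) hn₁ hR1 H jhalf
  have hPK : ∀ K, K₀ ≤ K → ∀ τ ∈ badTerms (memOf ped liveC cellOf) jhalf T K, ∀ q ∈ memOf ped liveC cellOf K τ,
      ∀ e ∈ q.2.events, (Prod.fst e).kind = 0 →
        P ≤ p0Profile C.A₀ C.p₀ ((D.C ⟨K, F.m, g₀ K⟩).flow.g (Prod.fst e).step) :=
    fun K hK τ hτ q hq e he _ => hP K hK _ ((HT.consistent K hK τ hτ q hq).step_le e he)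
  -- the per-occupant bound from the slot multiplicity, for a cost reading `κ₀`
  have hoccOf : ∀ κ₀ : ℕ → (Fin d → ℕ) × Gen (Lab α π) → Gen (Lab α π) → ℕ → ℝ,
      (∀ K, K₀ ≤ K → ∀ τ ∈ badTerms (memOf ped liveC cellOf) jhalf T K, ∀ q ∈ memOf ped liveC cellOf K τ,
        ∀ m ∈ life (padW (dictWT Prod.fst (R K) C.n₁) 0) q.2, κ₀ K q q.2 m ≤ costT Prod.fst C K (R K) q.2 m) →
      ∀ K, K₀ ≤ K → ∀ s, ∀ w ∈ koccOf ped liveC cellOf phys jhalf T K s,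
        ((koccOf ped liveC cellOf phys jhalf T K s).card : ℝ) *
            supPriceK ped liveC cellOf phys jhalf T
              (fun K q => pshapeTH Prod.fst O C 1 Λr (R K) (D.C ⟨K, F.m, g₀ K⟩).flow.g 0 (κ₀ K q) q.2 *
                Real.exp (-Ξ K q)) K w ≤
          bslotPrice (yT Prod.fst C ((F.L : ℝ) ^ d) R (fun K => (D.C ⟨K, F.m, g₀ K⟩).flow.g)
            (memOf ped liveC cellOf) jhalf T K) s := by
    intro κ₀ hκ₀ K hK
    refine hocc_of_boundK fun τ hτ c hc => ?_
    have hq : (cellOf K τ c, (ped K τ).genT c) ∈ memOf ped liveC cellOf K τ := mem_memOf.2 ⟨c, hc, rfl⟩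
    exact card_mul_pshapeTH_le_priceT_of_profile Prod.fst hθ hslack hP1 hΛm hΛr hΛmr R
      (fun K => (D.C ⟨K, F.m, g₀ K⟩).flow.g) K (hPK K hK τ hτ _ hq) (hκ₀ K hK τ hτ _ hq) (hmult K hK τ hτ c hc)
  have hpr : ∀ (κ₀ : ℕ → (Fin d → ℕ) × Gen (Lab α π) → Gen (Lab α π) → ℕ → ℝ) (K : ℕ)
      (q : (Fin d → ℕ) × Gen (Lab α π)),
      0 ≤ pshapeTH Prod.fst O C 1 Λr (R K) (D.C ⟨K, F.m, g₀ K⟩).flow.g 0 (κ₀ K q) q.2 * Real.exp (-Ξ K q) :=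
    fun κ₀ K q => mul_nonneg (pshapeTH_nonneg Prod.fst zero_le_one hΛr _ _ _ _ _) (Real.exp_pos _).le
  exact hybridNE7_of_termReadingLE_mult D Prod.fst h hμ d n (dcapOf Prod.fst T (memOf ped liveC cellOf))
    (ncapOf T (memOf ped liveC cellOf)) hκ₁ hE₀ hb hlo hhi hγ hγβ S hp₀ hrr ht hir hsign hcor hγB hobs hbd hα hα' hc₀
    hfloor hfloor' hsites hsites' hNup hnup hmup R hR (memOf ped liveC cellOf) HT
    (kmemOf ped liveC cellOf phys) kslot
    (fun K hK τ hτ => image_kslot_kmemOf)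
    (fun K hK τ hτ => injOn_kslot_kmemOf (H.cell_inj K hK τ (mem_badTerms.1 hτ).1))
    (supPriceK ped liveC cellOf phys jhalf T fun K q =>
      pshapeTH Prod.fst O C 1 Λr (R K) (D.C ⟨K, F.m, g₀ K⟩).flow.g 0 (κ K q) q.2 * Real.exp (-Ξ K q))
    (supPriceK ped liveC cellOf phys jhalf T fun K q =>
      pshapeTH Prod.fst O C 1 Λr (R K) (D.C ⟨K, F.m, g₀ K⟩).flow.g 0 (κ' K q) q.2 * Real.exp (-Ξ K q))
    (fun K w => supPriceK_nonneg (hpr κ K) w) (fun K w => supPriceK_nonneg (hpr κ' K) w)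
    (hoccOf κ hκ) (hoccOf κ' hκ')
    (fun K t ht hK τ hτ => (hPM K t ht hK τ hτ).trans
      (prod_memOf_le_prod_supPriceK (phys := phys)
        (pr := fun K q => pshapeTH Prod.fst O C 1 Λr (R K) (D.C ⟨K, F.m, g₀ K⟩).flow.g 0 (κ K q) q.2 *
          Real.exp (-Ξ K q)) (hpr κ K) hτ (H.cell_inj K hK τ (mem_badTerms.1 hτ).1)))
    (fun K t ht hK τ hτ => (hPM' K t ht hK τ hτ).trans
      (prod_memOf_le_prod_supPriceK (phys := phys)
        (pr := fun K q => pshapeTH Prod.fst O C 1 Λr (R K) (D.C ⟨K, F.m, g₀ K⟩).flow.g 0 (κ' K q) q.2 *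
          Real.exp (-Ξ K q)) (hpr κ' K) hτ (H.cell_inj K hK τ (mem_badTerms.1 hτ).1)))
    upM deadM_nonneg resumM FM_nonneg upM' deadM'_nonneg resumM' FM'_nonneg hSh hTB hr hu hs hs₂

end End

end

end Summit.QuantumFields.BalabanUV.T4Continuum.HistoryAssemblyRealiseRunMultP
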